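/-
# [B4] THEOREM (1.10), DERIVATIVE MEMBER, ON A BOX — HYPOTHESIS-FREE FOR A (1.7)-REGULAR FIELD CONSTANT NEAR `∂Ω`
(R9 carrier bridge, file 8)

statement-level skeleton of published theorems with citation tags; proofs where landed; nothing here is a claim about
the Yang–Mills mass gap

[B4] = Balaban, *Regularity and decay of lattice Green's functions*, Commun. Math. Phys. 89 (1983) 571–597.

THEOREM p.573, (1.10) second member «|(D^η_{A,μ}G_k(Ω,A)f)(x)| ≤ c₀e^{−δ₀dist(x,supp f)}‖f‖_∞ … for A satisfying (1.7)
with e sufficiently small»; p.581 «Only here we needed the assumption that A is constant in a neighbourhood of ∂□».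

`B4Thm110BoxDerivWalk.thm110_deriv_box_cubeField` (file 7) reduced the derivative member on `Ω = Box d ℓ k Mb` for the
component field `A = compField Ac` and the print's cube configurations `Ã_j` to the per-cube inputs
`‖G_k(Ω,Ã_j)Φ‖_∞ ≤ c_G‖Φ‖_∞`, `‖D^η_{Ã_j,μ}G_k(Ω,Ã_j)Φ‖_∞ ≤ c_D‖Φ‖_∞`, `‖K_{h_j}G_k(Ω,Ã_j)h_jΦ‖_∞ ≤ c_K‖Φ‖_∞`,
`3^{d+1}√N c_K ≤ e^{−1}`.  THIS FILE discharges them exactly as `B4Thm110BoxRegular` did for the value member: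
interior cubes by p35's `B4Eq220CubeField.lemma22_sup_cubeField` (BOTH clauses, `n = 0, 1`) / `eq220_cubeField`; all
other cubes by the constant configuration (`B4Thm110BoxRegular.cubeField_eq_constBond_of_collar`, the bond congruences
`greenA_congr_bonds`/`kOp_congr_bonds` and the new `derivA_congr_bonds`, the constant-field inputs
`B4Thm110BoxRegular.const_inputs` and the new `const_inputs_deriv` from `B4Lemma22ReduceZero.const_box_sup` (.2));
the large-cube size `K = 8(⌈3^{d+1}√N(C₂ + C₀)e⌉ + 1)` as in file 6.

MAIN THEOREM `thm110_deriv_box_regular`: there are `K` (`8 ≤ K`, `4 ∣ K`) and `c₁ > 0` such that for all `c ≥ 0`, `β > 0`,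
`S` there is `e₁ > 0` with: for every `k ≥ 1`, `(a,m²)` in the window, box `Ω` with `K ∣ Mb_μ ≤ S`, component field
`A` (1.7)-regular on `Ω` with `0 < e ≤ e₁` and `A = A(0)` on the collar of width `K` at `∂Ω`, direction `μ`, fine site
`x` with `x + e_μ ∈ Ω`, set `P` at unit-lattice sup-distance `≥ D` from `x`, source `f` supported in `P`:
`|(D^η_{A,μ}G_k(Ω,A)f)(x)| ≤ c₁e^{−D/K}‖f‖_∞` — (1.10), derivative member, `δ₀ = 1/K`, the constant uniform in `η = L^{-k}`.

HONEST SCOPE.  As `B4Thm110BoxRegular` (boxes; lineage's (1.6); `A₀ := A(0)` makes `e₁` depend on the box-size bound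
`S`; collar width `K`); forward bond inside `Ω`; `ℓ^∞` over sites and colours.  No `Prop` fact, no `sorry`; axioms standard.
-/
import Literature.MathematicalPhysics.QuantumFieldTheory.Balaban1983to89.B4Thm110BoxDerivWalk
import Literature.MathematicalPhysics.QuantumFieldTheory.Balaban1983to89.B4Thm110BoxRegular

namespace Literature.MathematicalPhysics.QuantumFieldTheory.Balaban1983to89.B4Thm110BoxDerivRegular

open Literature.MathematicalPhysics.QuantumFieldTheory.Balaban1983to89.B4Reflection242 (boxDom nbrs mem_nbrs)
open Literature.MathematicalPhysics.QuantumFieldTheory.Balaban1983to89.B4GaugeCovariance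
open Literature.MathematicalPhysics.QuantumFieldTheory.Balaban1983to89.B4Commutators25to211 (mulH)
open Literature.MathematicalPhysics.QuantumFieldTheory.Balaban1983to89.B4Lower18Regular (e1 baseEmb stairContour
  stairContour_end)
open Literature.MathematicalPhysics.QuantumFieldTheory.Balaban1983to89.B4Lower18RegularRegion (compField)
open Literature.MathematicalPhysics.QuantumFieldTheory.Balaban1983to89.B4Lemma21Region (covDeriv dirKer)
open Literature.MathematicalPhysics.QuantumFieldTheory.Balaban1983to89.B4Lemma22ReduceZero (Box opA greenA derivA greenA0
  derivA0 const_box_sup)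
open Literature.MathematicalPhysics.QuantumFieldTheory.Balaban1983to89.B4Lemma22Reduce231 (supN supN_nonneg)
open Literature.MathematicalPhysics.QuantumFieldTheory.Balaban1983to89.B4PartitionUnity22 (hCube hprof D1 D2 D1_nonneg
  D2_nonneg contDiff_hprof hasCompactSupport_hprof)
open Literature.MathematicalPhysics.QuantumFieldTheory.Balaban1983to89.B4Eq220PartitionSizes (hBox)
open Literature.MathematicalPhysics.QuantumFieldTheory.Balaban1983to89.B4Eq220CommutatorField (kOp)
open Literature.MathematicalPhysics.QuantumFieldTheory.Balaban1983to89.B4CubeFields22 (cubeField)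
open Literature.MathematicalPhysics.QuantumFieldTheory.Balaban1983to89.B4CubeFieldHyps22 (greenA_smul derivA_smul
  constBond_smul)
open Literature.MathematicalPhysics.QuantumFieldTheory.Balaban1983to89.B4Eq220CubeField (eq220_cubeField
  lemma22_sup_cubeField)
open Literature.MathematicalPhysics.QuantumFieldTheory.Balaban1983to89.B4BoxCubeGeometry (posR labels)
open Literature.MathematicalPhysics.QuantumFieldTheory.Balaban1983to89.B4Thm110BoxRegular (greenA_congr_bonds
  kOp_congr_bonds cubeField_eq_constBond_of_collar const_inputs)
open Literature.MathematicalPhysics.QuantumFieldTheory.Balaban1983to89.B4Thm110BoxDerivWalk (thm110_deriv_box_cubeField)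
open scoped Matrix

noncomputable section

variable {d : ℕ}
variable {ι : Type} [Fintype ι] [DecidableEq ι]

/-! ## 1. `D^η_{A,μ}` depends on the configuration only through its bond values -/

/-- **`D^η_{A,μ}` (1.3) DEPENDS ON `A` ONLY THROUGH ITS VALUES ON NEAREST-NEIGHBOUR BONDS.**
[cite: Balaban1983RegularityDecay, (1.3) p.572] -/
theorem derivA_congr_bonds (F : OrthFlow ι) (κ : ℝ) {ℓ k : ℕ} (M : Fin (d + 1) → ℕ)
    {B B' : ↥(Box d ℓ k M) → ↥(Box d ℓ k M) → ℝ}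
    (h : ∀ u v : ↥(Box d ℓ k M), v.1 ∈ nbrs u.1 → B u v = B' u v) (μ : Fin (d + 1)) :
    derivA d F κ ℓ k M B μ = derivA d F κ ℓ k M B' μ := by
  unfold derivA covDeriv
  congr 1
  funext x z
  unfold dirKer
  by_cases hz : z.1 = x.1 + e1 μ
  · have hzn : z.1 ∈ nbrs x.1 := mem_nbrs.2 ⟨μ, Or.inl hz⟩
    have hW : fieldLink F κ B x z = fieldLink F κ B' x z := by
      show F.U (κ * B x z) = F.U (κ * B' x z)
      rw [h x z hzn]
    rw [hW]
  · rw [if_neg hz, if_neg hz]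

/-! ## 2. The derivative input at a constant configuration, uniformly in the charge -/

/-- **LEMMA 2.2 (2.17), `n = 1`, AT A CONSTANT CONFIGURATION, EVERY CHARGE**: `‖D^η_{A₀,μ}G_k(□,A₀)Φ‖_∞ ≤ c_D‖Φ‖_∞`
(the gauge step `B4Lemma22ReduceZero.const_box_sup`, second clause; charge uniformity by `κA₀ = (κA₀)`).
[cite: Balaban1983RegularityDecay, Lemma 2.2 (2.17) p.578; p.581] -/
theorem const_inputs_deriv (F : OrthFlow ι) (d ℓ : ℕ) (hℓ : 1 ≤ ℓ) (amin aplus m2plus : ℝ) (ha : 0 < amin) :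
    ∃ cD₀ : ℝ, 0 < cD₀ ∧ ∀ (k : ℕ), 1 ≤ k → ∀ (hn : 1 ≤ (ℓ + 1) ^ k) (a m2 : ℝ),
      amin ≤ a → a ≤ aplus → 0 ≤ m2 → m2 ≤ m2plus → ∀ (M : Fin (d + 1) → ℕ), (∀ i, 1 ≤ M i) →
      ∀ (κ : ℝ) (A₀ : Fin (d + 1) → ℝ) (μ : Fin (d + 1)) (Φ : ↥(Box d ℓ k M) × ι → ℝ),
        supN (derivA d F κ ℓ k M (constBond A₀ Subtype.val) μ
          *ᵥ (greenA d F κ ℓ k a m2 M (baseEmb hn M) (stairContour hn M) (constBond A₀ Subtype.val) *ᵥ Φ))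
          ≤ cD₀ * supN Φ := by
  obtain ⟨c₁, hc₁, h₁⟩ := const_box_sup F 1 d ℓ hℓ amin aplus m2plus ha
  refine ⟨c₁, hc₁, ?_⟩
  intro k hk hn a m2 e1' e2 e3 e4 M hM κ A₀ μ Φ
  have hκ : (fun u v : ↥(Box d ℓ k M) => κ * constBond A₀ Subtype.val u v)
      = constBond (fun ν => κ * A₀ ν) Subtype.val := by
    funext u v
    exact constBond_smul κ A₀ _ u v
  rw [greenA_smul, derivA_smul, hκ]
  exact (h₁ k hk a m2 e1' e2 e3 e4 M hM (baseEmb hn M) (stairContour hn M) (stairContour_end hn M)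
    (fun ν => κ * A₀ ν)).2 μ Φ

/-! ## 3. THEOREM (1.10), derivative member, on a box — hypothesis-free for a regular field constant near `∂Ω` -/

omit [Fintype ι] [DecidableEq ι] in
/-- a label that is not interior is a boundary/outer label (box sides multiples of `K`).
[cite: Balaban1983RegularityDecay, §2 p.575, dictionary] -/
private theorem nonint {K : ℕ} {Mb : Fin (d + 1) → ℕ} {j : Fin (d + 1) → ℤ} (hKM : ∀ μ, K ∣ Mb μ)
    (h : ¬ ∀ μ, 1 ≤ j μ ∧ (K : ℤ) * (j μ + 1) ≤ (Mb μ : ℤ)) : ∃ μ, j μ ≤ 0 ∨ (Mb μ : ℤ) ≤ (K : ℤ) * j μ := by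
  obtain ⟨μ, hμ⟩ := not_forall.mp h
  refine ⟨μ, ?_⟩
  by_cases h1 : 1 ≤ j μ
  · right
    have h2 : ¬ (K : ℤ) * (j μ + 1) ≤ (Mb μ : ℤ) := fun h2 => hμ ⟨h1, h2⟩
    obtain ⟨t, ht⟩ := hKM μ
    have ht' : (Mb μ : ℤ) = (K : ℤ) * t := by exact_mod_cast ht
    rw [ht'] at h2 ⊢
    have hK0 : (0 : ℤ) ≤ K := Nat.cast_nonneg K
    have : (t : ℤ) < j μ + 1 := Int.lt_of_mul_lt_mul_left (not_le.mp h2) hK0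
    exact mul_le_mul_of_nonneg_left (by omega) hK0
  · left
    omega

/-- **THEOREM (1.10) OF [B4] ON A BOX, DERIVATIVE MEMBER — FOR A (1.7)-REGULAR FIELD CONSTANT NEAR `∂Ω`, WITH «e
SUFFICIENTLY SMALL» AND THE LARGE-CUBE SIZE CHOSEN, THE CONSTANT UNIFORM IN THE LATTICE SPACING `η = L^{-k}`**: there are
`K` (`8 ≤ K`, `4 ∣ K`) and `c₁ > 0` such that for all `c ≥ 0`, `β > 0`, `S` there is `e₁ > 0` with — for every `k ≥ 1`,
`(a,m²) ∈ [a₋,a₊]×[0,m²₊]`, box `Ω = Π[0, nMb_μ)` with `K ∣ Mb_μ`, `1 ≤ Mb_μ ≤ S`, component field `A` with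
`|A_ν(x+e_μ) − A_ν(x)| ≤ c·e^{β−1}η` on `Ω`, `0 < e ≤ e₁`, `A = A(0)` on the collar of width `K` at `∂Ω`, direction `μ`,
fine site `x` with `x + e_μ ∈ Ω`, set `P` with `|x/n − x′/n|_∞ ≥ D` on `P`, source `f` supported in `P` with `|f| ≤ φ` —
`|(D^η_{A,μ}G_k(Ω,A)f)(x)| ≤ c₁·e^{−D/K}·φ`. [cite: Balaban1983RegularityDecay, Theorem (1.10) p.573; pp.575–579, p.581] -/
theorem thm110_deriv_box_regular (F : OrthFlow ι) {ℓ₁ : ℝ} (hℓ₁ : 0 ≤ ℓ₁)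
    (hLip : ∀ t (v : ι → ℝ), ((F.U t - 1) *ᵥ v) ⬝ᵥ ((F.U t - 1) *ᵥ v) ≤ (ℓ₁ * t) ^ 2 * (v ⬝ᵥ v))
    (d ℓ : ℕ) (hℓ : 1 ≤ ℓ) (amin aplus m2plus : ℝ) (ha : 0 < amin) :
    ∃ K : ℕ, 8 ≤ K ∧ 4 ∣ K ∧ ∃ c₁ : ℝ, 0 < c₁ ∧ ∀ (creg β : ℝ), 0 ≤ creg → 0 < β → ∀ (S : ℕ),
      ∃ e₁ : ℝ, 0 < e₁ ∧ ∀ (k : ℕ), 1 ≤ k → ∀ (hn : 1 ≤ (ℓ + 1) ^ k) (a m2 : ℝ),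
      amin ≤ a → a ≤ aplus → 0 ≤ m2 → m2 ≤ m2plus →
      ∀ (Mb : Fin (d + 1) → ℕ), (∀ i, 1 ≤ Mb i) → (∀ i, Mb i ≤ S) → (∀ μ, K ∣ Mb μ) →
      ∀ (Ac : (Fin (d + 1) → ℤ) → Fin (d + 1) → ℝ) (e : ℝ), 0 < e → e ≤ e₁ →
        (∀ x ∈ Box d ℓ k Mb, ∀ μ ν : Fin (d + 1),
          |Ac (x + e1 μ) ν - Ac x ν| ≤ creg * e ^ (β - 1) / ((ℓ + 1) ^ k : ℕ)) →
        (∀ w ∈ Box d ℓ k Mb, (∃ μ, w μ < (((ℓ + 1) ^ k : ℕ) : ℤ) * K ∨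
            (((ℓ + 1) ^ k : ℕ) : ℤ) * Mb μ < w μ + (((ℓ + 1) ^ k : ℕ) : ℤ) * K) → ∀ ν, Ac w ν = Ac 0 ν) →
      ∀ (μ : Fin (d + 1)) (x : ↥(Box d ℓ k Mb)), x.1 + e1 μ ∈ Box d ℓ k Mb →
      ∀ (P : ↥(Box d ℓ k Mb) → Prop) [DecidablePred P] (D : ℝ),
        (∀ x', P x' → ∃ ν, D ≤ |posR ℓ k Mb x ν - posR ℓ k Mb x' ν|) →
      ∀ (f : ↥(Box d ℓ k Mb) × ι → ℝ), (∀ p, ¬ P p.1 → f p = 0) → ∀ (φ : ℝ), 0 ≤ φ → (∀ p, |f p| ≤ φ) →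
      ∀ i : ι,
        |(derivA d F (e / ((ℓ + 1) ^ k : ℕ)) ℓ k Mb (fun u v : ↥(Box d ℓ k Mb) => compField Ac u.1 v.1) μ
            *ᵥ (greenA d F (e / ((ℓ + 1) ^ k : ℕ)) ℓ k a m2 Mb (baseEmb hn Mb) (stairContour hn Mb)
                (fun u v : ↥(Box d ℓ k Mb) => compField Ac u.1 v.1) *ᵥ f)) (x, i)|
          ≤ c₁ * Real.exp (-(D / K)) * φ := by
  obtain ⟨C₁, hC₁, h₁⟩ := lemma22_sup_cubeField F hℓ₁ hLip d ℓ hℓ amin aplus m2plus ha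
  obtain ⟨C₂, hC₂, h₂⟩ := eq220_cubeField F hℓ₁ hLip d ℓ hℓ amin aplus m2plus ha
  obtain ⟨cG₀, cK₀, hcG₀, hcK₀, h₀⟩ := const_inputs F hℓ₁ hLip d ℓ hℓ amin aplus m2plus ha
  obtain ⟨cD₀, hcD₀, h₀'⟩ := const_inputs_deriv F d ℓ hℓ amin aplus m2plus ha
  set X : ℝ := (3 : ℝ) ^ (d + 1) * Real.sqrt (Fintype.card ι) * (C₂ + cK₀) * Real.exp 1 with hX
  have hX0 : 0 ≤ X := by positivity
  set K : ℕ := 8 * (⌈X⌉₊ + 1) with hK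
  have hK8 : 8 ≤ K := by omega
  have h4 : 4 ∣ K := ⟨2 * (⌈X⌉₊ + 1), by omega⟩
  have hK2 : 2 ≤ K := by omega
  have hK1 : 1 ≤ K := by omega
  have hKr : (0 : ℝ) < K := by exact_mod_cast hK1
  have hKX : X ≤ K := by
    refine (Nat.le_ceil X).trans ?_
    rw [hK]
    push_cast
    linarith [(Nat.cast_nonneg ⌈X⌉₊ : (0 : ℝ) ≤ ⌈X⌉₊)]
  set cG : ℝ := max C₁ cG₀ with hcG_def
  set cD : ℝ := max C₁ cD₀ with hcD_def
  set cK : ℝ := (C₂ + cK₀) / K with hcK_def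
  have hcG : 0 ≤ cG := hC₁.le.trans (le_max_left _ _)
  have hcD : 0 ≤ cD := hC₁.le.trans (le_max_left _ _)
  have hcK : 0 ≤ cK := div_nonneg (by positivity) hKr.le
  have h3 : (3 : ℝ) ^ (d + 1) * (Real.sqrt (Fintype.card ι) * cK) ≤ Real.exp (-1) := by
    have hexp : Real.exp 1 * Real.exp (-1) = 1 := by rw [← Real.exp_add]; norm_num
    have e : (3 : ℝ) ^ (d + 1) * (Real.sqrt (Fintype.card ι) * cK) = X / K * Real.exp (-1) := by
      rw [hcK_def, hX]
      calc (3 : ℝ) ^ (d + 1) * (Real.sqrt (Fintype.card ι) * ((C₂ + cK₀) / K))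
          = (3 : ℝ) ^ (d + 1) * Real.sqrt (Fintype.card ι) * (C₂ + cK₀) / K * (Real.exp 1 * Real.exp (-1)) := by
            rw [hexp]; ring
        _ = (3 : ℝ) ^ (d + 1) * Real.sqrt (Fintype.card ι) * (C₂ + cK₀) * Real.exp 1 / K * Real.exp (-1) := by
            ring
    rw [e]
    have : X / K ≤ 1 := div_le_one_of_le₀ hKX (Nat.cast_nonneg K)
    calc X / K * Real.exp (-1) ≤ 1 * Real.exp (-1) := mul_le_mul_of_nonneg_right this (Real.exp_pos _).le
      _ = Real.exp (-1) := one_mul _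
  have hs0 : 0 ≤ ((d : ℝ) + 1) * (D1 hprof + D2 hprof) := by
    have := D1_nonneg contDiff_hprof hasCompactSupport_hprof
    have := D2_nonneg contDiff_hprof hasCompactSupport_hprof
    positivity
  set c₁ : ℝ := 2 ^ (d + 3) * Real.exp (19 / 8)
    * (Real.sqrt (Fintype.card ι) * cD
        + ((d : ℝ) + 1) * (D1 hprof + D2 hprof) / K
            * ((Fintype.card ι : ℝ) * (Real.sqrt (Fintype.card ι) * cG))) + 1 with hc₁
  refine ⟨K, hK8, h4, c₁, by positivity, fun creg β hcreg hβ S => ?_⟩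
  obtain ⟨e₁, he₁, h₁'⟩ := h₁ creg β hcreg hβ S K hK1
  obtain ⟨e₂, he₂, h₂'⟩ := h₂ creg β hcreg hβ S K hK2
  refine ⟨min e₁ e₂, lt_min he₁ he₂, ?_⟩
  intro k hk hn a m2 ea1 ea2 em1 em2 Mb hM hS hKM Ac e he hle h17 hcol μ x hxμ P _ D hD f hfP φ hφ hf i
  have hn2 : 2 ≤ (ℓ + 1) ^ k := by
    calc 2 ≤ ℓ + 1 := by omega
      _ = (ℓ + 1) ^ 1 := (pow_one _).symm
      _ ≤ (ℓ + 1) ^ k := Nat.pow_le_pow_right (Nat.succ_pos ℓ) hk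
  have hnK : 16 ≤ (ℓ + 1) ^ k * K := by nlinarith
  have ha' : 0 < a := lt_of_lt_of_le ha ea1
  have hcol' : ∀ w : ↥(Box d ℓ k Mb), (∃ μ, w.1 μ < (((ℓ + 1) ^ k : ℕ) : ℤ) * K ∨
      (((ℓ + 1) ^ k : ℕ) : ℤ) * Mb μ < w.1 μ + (((ℓ + 1) ^ k : ℕ) : ℤ) * K) → ∀ ν, Ac w.1 ν = Ac 0 ν :=
    fun w hw => hcol w.1 w.2 hw
  have hG : ∀ j ∈ labels Mb, ∀ Φ : ↥(Box d ℓ k Mb) × ι → ℝ,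
      supN (greenA d F (e / ((ℓ + 1) ^ k : ℕ)) ℓ k a m2 Mb (baseEmb hn Mb) (stairContour hn Mb)
          (cubeField (Box d ℓ k Mb) ((ℓ + 1) ^ k) K j (Ac 0) Ac) *ᵥ Φ) ≤ cG * supN Φ := by
    intro j _ Φ
    by_cases hint : ∀ μ, 1 ≤ j μ ∧ (K : ℤ) * (j μ + 1) ≤ (Mb μ : ℤ)
    · have hb := (h₁' k hk hn hnK a m2 ea1 ea2 em1 em2 Mb hM hS j (fun μ => (hint μ).1) (fun μ => (hint μ).2)
        Ac e he (hle.trans (min_le_left _ _)) h17 Φ).1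
      exact hb.trans (mul_le_mul_of_nonneg_right (le_max_left _ _) (supN_nonneg Φ))
    · rw [greenA_congr_bonds F _ hn a m2 Mb (cubeField_eq_constBond_of_collar hn hK1 Ac (nonint hKM hint) hcol')]
      exact ((h₀ k hk hn a m2 ea1 ea2 em1 em2 Mb hM K j hK2 hKM _ (Ac 0)).1 Φ).trans
        (mul_le_mul_of_nonneg_right (le_max_right _ _) (supN_nonneg Φ))
  have hDG : ∀ j ∈ labels Mb, ∀ Φ : ↥(Box d ℓ k Mb) × ι → ℝ,
      supN (derivA d F (e / ((ℓ + 1) ^ k : ℕ)) ℓ k Mb (cubeField (Box d ℓ k Mb) ((ℓ + 1) ^ k) K j (Ac 0) Ac) μ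
        *ᵥ (greenA d F (e / ((ℓ + 1) ^ k : ℕ)) ℓ k a m2 Mb (baseEmb hn Mb) (stairContour hn Mb)
            (cubeField (Box d ℓ k Mb) ((ℓ + 1) ^ k) K j (Ac 0) Ac) *ᵥ Φ)) ≤ cD * supN Φ := by
    intro j _ Φ
    by_cases hint : ∀ μ, 1 ≤ j μ ∧ (K : ℤ) * (j μ + 1) ≤ (Mb μ : ℤ)
    · have hb := (h₁' k hk hn hnK a m2 ea1 ea2 em1 em2 Mb hM hS j (fun μ => (hint μ).1) (fun μ => (hint μ).2)
        Ac e he (hle.trans (min_le_left _ _)) h17 Φ).2 μ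
      exact hb.trans (mul_le_mul_of_nonneg_right (le_max_left _ _) (supN_nonneg Φ))
    · have hb := cubeField_eq_constBond_of_collar hn hK1 Ac (nonint hKM hint) hcol'
      rw [derivA_congr_bonds F _ Mb hb μ, greenA_congr_bonds F _ hn a m2 Mb hb]
      exact (h₀' k hk hn a m2 ea1 ea2 em1 em2 Mb hM _ (Ac 0) μ Φ).trans
        (mul_le_mul_of_nonneg_right (le_max_right _ _) (supN_nonneg Φ))
  have hKG : ∀ j ∈ labels Mb, ∀ Φ : ↥(Box d ℓ k Mb) × ι → ℝ,
      supN (kOp F (e / ((ℓ + 1) ^ k : ℕ)) ((ℓ + 1) ^ k) (B1.aSeq a ((ℓ : ℝ) + 1) k) m2 Mb (baseEmb hn Mb)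
            (stairContour hn Mb) (cubeField (Box d ℓ k Mb) ((ℓ + 1) ^ k) K j (Ac 0) Ac) (hBox ((ℓ + 1) ^ k) K Mb j)
          *ᵥ (greenA d F (e / ((ℓ + 1) ^ k : ℕ)) ℓ k a m2 Mb (baseEmb hn Mb) (stairContour hn Mb)
              (cubeField (Box d ℓ k Mb) ((ℓ + 1) ^ k) K j (Ac 0) Ac)
            *ᵥ (mulH (ι := ι) (hBox ((ℓ + 1) ^ k) K Mb j) *ᵥ Φ))) ≤ cK * supN Φ := by
    intro j _ Φ
    have hsplit : ∀ t : ℝ, 0 ≤ t → t ≤ C₂ + cK₀ → t / K * supN Φ ≤ cK * supN Φ := fun t _ ht =>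
      mul_le_mul_of_nonneg_right (div_le_div_of_nonneg_right ht hKr.le) (supN_nonneg Φ)
    by_cases hint : ∀ μ, 1 ≤ j μ ∧ (K : ℤ) * (j μ + 1) ≤ (Mb μ : ℤ)
    · have hb := h₂' k hk hn hnK a m2 ea1 ea2 em1 em2 Mb hM hS hKM j (fun μ => (hint μ).1)
        (fun μ => (hint μ).2) Ac e he (hle.trans (min_le_right _ _)) h17 Φ
      exact hb.trans (hsplit C₂ hC₂.le (by linarith))
    · have hb := cubeField_eq_constBond_of_collar hn hK1 Ac (nonint hKM hint) hcol'
      rw [kOp_congr_bonds F _ hn a m2 Mb hb, greenA_congr_bonds F _ hn a m2 Mb hb]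
      exact ((h₀ k hk hn a m2 ea1 ea2 em1 em2 Mb hM K j hK2 hKM _ (Ac 0)).2 Φ).trans
        (hsplit cK₀ hcK₀.le (by linarith))
  have main := thm110_deriv_box_cubeField F hℓ hk hn Mb hK8 h4 hKM ha' em1 e Ac hcG hcD hcK hG μ hDG hKG h3 x
    hxμ P hD f hfP hφ hf i
  refine main.trans (mul_le_mul_of_nonneg_right (mul_le_mul_of_nonneg_right ?_ (Real.exp_pos _).le) hφ)
  rw [hc₁]
  linarith

end

end Literature.MathematicalPhysics.QuantumFieldTheory.Balaban1983to89.B4Thm110BoxDerivRegular
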